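import Mathlib
import Literature.Barriers.MatrixMultiplication.NormalizerBarrier

/-!
# Stub `stub_levelOneSandwichRigidity` — line `ghost-calculus-chebotarev` of the crux
`SubgroupIdentityDesigns` (stmt-MatrixMultiplication-14079)

Crux
`Summit.MatrixMultiplication.MatrixMultiplication.Theses.LevelGradedCohnUmans.SubgroupIdentityDesigns`;
this file proves the registered NEGATIVE helper `stub_levelOneSandwichRigidity` verbatim (name +
signature): a structure theorem for level-`1` sandwich witnesses.  Pure group theory / matrix
bookkeeping, no Fourier analysis.

Setting.  `G = GL_{n+1}(𝔽_p)`, three subgroups `H₁, H₂, H₃ ≤ G` with the subgroup triple product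
property (`Literature.Barriers.MatrixMultiplication.SubgroupTPP`), and the two corner root groups
`U⁻ = {u : (u - 1) i j ≠ 0 → 1 ≤ i ∧ j < 1}` (unipotents supported in column `0` below the corner)
and `U⁺ = {v : (v - 1) i j ≠ 0 → i < 1 ∧ 1 ≤ j}` (row `0` right of the corner).  Hypotheses:
`U⁻ ≤ H₁`, `U⁺ ≤ H₃`, and the SLICE property (every product `a b g`, `a ∈ H₁, b ∈ H₂, g ∈ H₃`, with
corner entry `(a b g)₀₀ = 1` factors as `u v` with `u` of `U⁻`-shape and `v` of `U⁺`-shape).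
Conclusions:

* (C1) every `h ∈ H₁` has `h 0 j = 0` for `j ≠ 0`;
* (C2) every `h ∈ H₁` with `h 0 0 = 1` is `U⁻`-shaped;
* (C3) every `h ∈ H₃` has `h i 0 = 0` for `i ≠ 0`;
* (C4) every `h ∈ H₃` with `h 0 0 = 1` is `U⁺`-shaped;
* (C5) `b ≠ 1 ⇒ (a b g)₀₀ ≠ 1`.

Proof.  TPP gives `H₁ ∩ H₃ = 1`.  (C5): a corner-`1` product slices as `a b g = u v`, so
`(u⁻¹ a) b (g v⁻¹) = 1` and TPP forces `b = 1`.  (C2)/(C4): slice `h = h·1·1 = u v`; then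
`v = u⁻¹ h ∈ H₁ ∩ H₃` (resp. `u = h v⁻¹ ∈ H₁ ∩ H₃`) is trivial, so `h = u` (resp. `h = v`).
(C1): if `h 0 j ≠ 0`, right-multiplying by the transvection `1 + c e_{j0} ∈ U⁻ ≤ H₁` with
`c h₀ⱼ = 1 - h₀₀` produces an element of `H₁` with corner `1` whose `(0, j)` entry is still
`h 0 j ≠ 0`, contradicting (C2); (C3) is the mirror image with `1 + c e_{0i} ∈ U⁺ ≤ H₃` acting on
the left and (C4).  Sorry-free; standard axioms.
-/

set_option linter.dupNamespace false

noncomputable section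

open scoped BigOperators
open Literature.Barriers.MatrixMultiplication

namespace Summit.MatrixMultiplication.MatrixMultiplication.Theorems.SubgroupIdentityDesigns.Negative

namespace LevelOneRigidity

/-! ## Trivial intersection of the outer groups -/

/-- Under the subgroup TPP, `H₁ ∩ H₃ = 1` (`t · 1 · t⁻¹ = 1`). [folklore] -/
theorem eq_one_of_mem_left_right {G : Type*} [Group G] {H₁ H₂ H₃ : Subgroup G}
    (htpp : SubgroupTPP H₁ H₂ H₃) {t : G} (h1 : t ∈ H₁) (h3 : t ∈ H₃) : t = 1 :=
  (htpp t h1 1 H₂.one_mem t⁻¹ (H₃.inv_mem h3) (by simp)).1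

/-! ## The two corner transvections -/

/-- **Lower corrector.**  If `h 0 j ≠ 0` for some `j ≠ 0`, the transvection `u = 1 + c e_{j0}` with
`c h₀ⱼ = 1 - h₀₀` is an invertible matrix of `U⁻`-shape (its only off-identity entry sits at
`(j, 0)`, `j ≥ 1`), right multiplication by it normalises the corner, `(h u)₀₀ = 1`, and leaves
column `j` untouched, `(h u)₀ⱼ = h₀ⱼ`. [folklore] -/
theorem exists_lower_corrector {K : Type*} [Field K] {n : ℕ}
    (h : Matrix (Fin (n + 1)) (Fin (n + 1)) K) {j : Fin (n + 1)} (hj : j ≠ 0)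
    (hne : h 0 j ≠ 0) :
    ∃ u : Matrix.GeneralLinearGroup (Fin (n + 1)) K,
      (∀ i j' : Fin (n + 1), ((u : Matrix (Fin (n + 1)) (Fin (n + 1)) K) - 1) i j' ≠ 0 →
          1 ≤ i.val ∧ j'.val < 1) ∧
        (h * (u : Matrix (Fin (n + 1)) (Fin (n + 1)) K)) 0 0 = 1 ∧
        (h * (u : Matrix (Fin (n + 1)) (Fin (n + 1)) K)) 0 j = h 0 j := by
  obtain ⟨c, hc⟩ : ∃ c : K, c * h 0 j = 1 - h 0 0 :=
    ⟨(1 - h 0 0) / h 0 j, div_mul_cancel₀ _ hne⟩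
  refine ⟨⟨Matrix.transvection j 0 c, Matrix.transvection j 0 (-c), ?_, ?_⟩, ?_, ?_, ?_⟩
  · rw [Matrix.transvection_mul_transvection_same _ _ hj, add_neg_cancel,
      Matrix.transvection_zero]
  · rw [Matrix.transvection_mul_transvection_same _ _ hj, neg_add_cancel,
      Matrix.transvection_zero]
  · intro i j' hij
    change (Matrix.transvection j 0 c - 1) i j' ≠ 0 at hij
    rw [Matrix.transvection, add_sub_cancel_left, Matrix.single_apply] at hij
    by_cases hcase : j = i ∧ (0 : Fin (n + 1)) = j'
    · obtain ⟨hji, h0j⟩ := hcase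
      rw [← hji, ← h0j]
      have hj0 : (j : ℕ) ≠ 0 := fun h0 => hj (Fin.val_eq_zero_iff.mp h0)
      exact ⟨Nat.one_le_iff_ne_zero.mpr hj0, by simp⟩
    · exact absurd (if_neg hcase) hij
  · change (h * Matrix.transvection j 0 c) 0 0 = 1
    rw [Matrix.mul_transvection_apply_same, hc]
    ring
  · change (h * Matrix.transvection j 0 c) 0 j = h 0 j
    exact Matrix.mul_transvection_apply_of_ne _ _ _ _ hj _ _

/-- **Upper corrector.**  If `h i 0 ≠ 0` for some `i ≠ 0`, the transvection `v = 1 + c e_{0i}`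
with `c hᵢ₀ = 1 - h₀₀` is an invertible matrix of `U⁺`-shape (its only off-identity entry sits at
`(0, i)`, `i ≥ 1`), left multiplication by it normalises the corner, `(v h)₀₀ = 1`, and leaves
row `i` untouched, `(v h)ᵢ₀ = hᵢ₀`. [folklore] -/
theorem exists_upper_corrector {K : Type*} [Field K] {n : ℕ}
    (h : Matrix (Fin (n + 1)) (Fin (n + 1)) K) {i : Fin (n + 1)} (hi : i ≠ 0)
    (hne : h i 0 ≠ 0) :
    ∃ v : Matrix.GeneralLinearGroup (Fin (n + 1)) K,
      (∀ i' j : Fin (n + 1), ((v : Matrix (Fin (n + 1)) (Fin (n + 1)) K) - 1) i' j ≠ 0 →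
          i'.val < 1 ∧ 1 ≤ j.val) ∧
        ((v : Matrix (Fin (n + 1)) (Fin (n + 1)) K) * h) 0 0 = 1 ∧
        ((v : Matrix (Fin (n + 1)) (Fin (n + 1)) K) * h) i 0 = h i 0 := by
  obtain ⟨c, hc⟩ : ∃ c : K, c * h i 0 = 1 - h 0 0 :=
    ⟨(1 - h 0 0) / h i 0, div_mul_cancel₀ _ hne⟩
  refine ⟨⟨Matrix.transvection 0 i c, Matrix.transvection 0 i (-c), ?_, ?_⟩, ?_, ?_, ?_⟩
  · rw [Matrix.transvection_mul_transvection_same _ _ hi.symm, add_neg_cancel,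
      Matrix.transvection_zero]
  · rw [Matrix.transvection_mul_transvection_same _ _ hi.symm, neg_add_cancel,
      Matrix.transvection_zero]
  · intro i' j hij
    change (Matrix.transvection 0 i c - 1) i' j ≠ 0 at hij
    rw [Matrix.transvection, add_sub_cancel_left, Matrix.single_apply] at hij
    by_cases hcase : (0 : Fin (n + 1)) = i' ∧ i = j
    · obtain ⟨h0i, hij'⟩ := hcase
      rw [← h0i, ← hij']
      have hi0 : (i : ℕ) ≠ 0 := fun h0 => hi (Fin.val_eq_zero_iff.mp h0)
      exact ⟨by simp, Nat.one_le_iff_ne_zero.mpr hi0⟩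
    · exact absurd (if_neg hcase) hij
  · change (Matrix.transvection 0 i c * h) 0 0 = 1
    rw [Matrix.transvection_mul_apply_same, hc]
    ring
  · change (Matrix.transvection 0 i c * h) i 0 = h i 0
    exact Matrix.transvection_mul_apply_of_ne _ _ _ _ hi _ _

end LevelOneRigidity

open LevelOneRigidity in
/-- **Level-one sandwich rigidity** (negative helper for the line `ghost-calculus-chebotarev` of the
crux `SubgroupIdentityDesigns`).  In `GL_{n+1}(𝔽_p)` let `H₁, H₂, H₃` satisfy the subgroup TPP, let
`H₁` contain the corner column root group `U⁻` and `H₃` the corner row root group `U⁺`, and assume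
the SLICE property: every product `a b g` (`a ∈ H₁, b ∈ H₂, g ∈ H₃`) with corner entry `1` factors
as `u v` with `u` of `U⁻`-shape and `v` of `U⁺`-shape.  Then (C1) `H₁` has zero first row off the
corner, (C2) the corner-`1` elements of `H₁` are exactly `U⁻`-shaped, (C3) `H₃` has zero first
column off the corner, (C4) the corner-`1` elements of `H₃` are `U⁺`-shaped, and (C5) a product
`a b g` with `b ≠ 1` never has corner entry `1`. -/
theorem stub_levelOneSandwichRigidity :
    ∀ (p : ℕ) [Fact p.Prime] (n : ℕ)
      (H₁ H₂ H₃ : Subgroup (Matrix.GeneralLinearGroup (Fin (n + 1)) (ZMod p))),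
      Literature.Barriers.MatrixMultiplication.SubgroupTPP H₁ H₂ H₃ →
      (∀ u : Matrix.GeneralLinearGroup (Fin (n + 1)) (ZMod p),
        (∀ i j : Fin (n + 1), ((u : Matrix (Fin (n + 1)) (Fin (n + 1)) (ZMod p)) - 1) i j ≠ 0 →
          1 ≤ i.val ∧ j.val < 1) → u ∈ H₁) →
      (∀ v : Matrix.GeneralLinearGroup (Fin (n + 1)) (ZMod p),
        (∀ i j : Fin (n + 1), ((v : Matrix (Fin (n + 1)) (Fin (n + 1)) (ZMod p)) - 1) i j ≠ 0 →
          i.val < 1 ∧ 1 ≤ j.val) → v ∈ H₃) →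
      (∀ a ∈ H₁, ∀ b ∈ H₂, ∀ g ∈ H₃,
        ((a * b * g : Matrix.GeneralLinearGroup (Fin (n + 1)) (ZMod p)) :
            Matrix (Fin (n + 1)) (Fin (n + 1)) (ZMod p)) 0 0 = 1 →
        ∃ u v : Matrix.GeneralLinearGroup (Fin (n + 1)) (ZMod p),
          (∀ i j : Fin (n + 1), ((u : Matrix (Fin (n + 1)) (Fin (n + 1)) (ZMod p)) - 1) i j ≠ 0 →
            1 ≤ i.val ∧ j.val < 1) ∧
          (∀ i j : Fin (n + 1), ((v : Matrix (Fin (n + 1)) (Fin (n + 1)) (ZMod p)) - 1) i j ≠ 0 →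
            i.val < 1 ∧ 1 ≤ j.val) ∧
          a * b * g = u * v) →
      (∀ h ∈ H₁, ∀ j : Fin (n + 1), j ≠ 0 →
        (h : Matrix (Fin (n + 1)) (Fin (n + 1)) (ZMod p)) 0 j = 0) ∧
      (∀ h ∈ H₁, (h : Matrix (Fin (n + 1)) (Fin (n + 1)) (ZMod p)) 0 0 = 1 →
        ∀ i j : Fin (n + 1), ((h : Matrix (Fin (n + 1)) (Fin (n + 1)) (ZMod p)) - 1) i j ≠ 0 →
          1 ≤ i.val ∧ j.val < 1) ∧
      (∀ h ∈ H₃, ∀ i : Fin (n + 1), i ≠ 0 →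
        (h : Matrix (Fin (n + 1)) (Fin (n + 1)) (ZMod p)) i 0 = 0) ∧
      (∀ h ∈ H₃, (h : Matrix (Fin (n + 1)) (Fin (n + 1)) (ZMod p)) 0 0 = 1 →
        ∀ i j : Fin (n + 1), ((h : Matrix (Fin (n + 1)) (Fin (n + 1)) (ZMod p)) - 1) i j ≠ 0 →
          i.val < 1 ∧ 1 ≤ j.val) ∧
      (∀ a ∈ H₁, ∀ b ∈ H₂, ∀ g ∈ H₃, b ≠ 1 →
        ((a * b * g : Matrix.GeneralLinearGroup (Fin (n + 1)) (ZMod p)) :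
            Matrix (Fin (n + 1)) (Fin (n + 1)) (ZMod p)) 0 0 ≠ 1) := by
  intro p _ n H₁ H₂ H₃ htpp hL hR hslice
  -- (T0) `H₁ ∩ H₃ = 1`.
  have h13 : ∀ t, t ∈ H₁ → t ∈ H₃ → t = 1 := fun t h1 h3 =>
    eq_one_of_mem_left_right htpp h1 h3
  -- (C5) `b ≠ 1 ⇒ corner ≠ 1`.
  have hC5 : ∀ a ∈ H₁, ∀ b ∈ H₂, ∀ g ∈ H₃, b ≠ 1 →
      ((a * b * g : Matrix.GeneralLinearGroup (Fin (n + 1)) (ZMod p)) :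
          Matrix (Fin (n + 1)) (Fin (n + 1)) (ZMod p)) 0 0 ≠ 1 := by
    intro a ha b hb g hg hb1 hcorner
    obtain ⟨u, v, hu, hv, he⟩ := hslice a ha b hb g hg hcorner
    have key : u⁻¹ * a * b * (g * v⁻¹) = 1 := by
      calc u⁻¹ * a * b * (g * v⁻¹) = u⁻¹ * (a * b * g) * v⁻¹ := by group
        _ = 1 := by rw [he]; group
    exact hb1 (htpp _ (H₁.mul_mem (H₁.inv_mem (hL u hu)) ha) b hb _
      (H₃.mul_mem hg (H₃.inv_mem (hR v hv))) key).2.1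
  -- (C2) corner-`1` elements of `H₁` are `U⁻`-shaped.
  have hC2 : ∀ h ∈ H₁, (h : Matrix (Fin (n + 1)) (Fin (n + 1)) (ZMod p)) 0 0 = 1 →
      ∀ i j : Fin (n + 1), ((h : Matrix (Fin (n + 1)) (Fin (n + 1)) (ZMod p)) - 1) i j ≠ 0 →
        1 ≤ i.val ∧ j.val < 1 := by
    intro h hh hcorner
    obtain ⟨u, v, hu, hv, he⟩ :=
      hslice h hh 1 H₂.one_mem 1 H₃.one_mem (by simpa only [mul_one] using hcorner)
    simp only [mul_one] at he
    have hv1 : v ∈ H₁ := by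
      have huv : u⁻¹ * h = v := by rw [he, inv_mul_cancel_left]
      exact huv ▸ H₁.mul_mem (H₁.inv_mem (hL u hu)) hh
    rw [h13 v hv1 (hR v hv), mul_one] at he
    subst he
    exact hu
  -- (C4) corner-`1` elements of `H₃` are `U⁺`-shaped.
  have hC4 : ∀ h ∈ H₃, (h : Matrix (Fin (n + 1)) (Fin (n + 1)) (ZMod p)) 0 0 = 1 →
      ∀ i j : Fin (n + 1), ((h : Matrix (Fin (n + 1)) (Fin (n + 1)) (ZMod p)) - 1) i j ≠ 0 →
        i.val < 1 ∧ 1 ≤ j.val := by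
    intro h hh hcorner
    obtain ⟨u, v, hu, hv, he⟩ :=
      hslice 1 H₁.one_mem 1 H₂.one_mem h hh (by simpa only [one_mul] using hcorner)
    simp only [one_mul] at he
    have hu3 : u ∈ H₃ := by
      have huv : h * v⁻¹ = u := by rw [he, mul_inv_cancel_right]
      exact huv ▸ H₃.mul_mem hh (H₃.inv_mem (hR v hv))
    rw [h13 u (hL u hu) hu3, one_mul] at he
    subst he
    exact hv
  -- (C1) `H₁` has zero first row off the corner.
  have hC1 : ∀ h ∈ H₁, ∀ j : Fin (n + 1), j ≠ 0 →
      (h : Matrix (Fin (n + 1)) (Fin (n + 1)) (ZMod p)) 0 j = 0 := by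
    intro h hh j hj
    by_contra hne
    obtain ⟨u, hu, hc0, hcj⟩ :=
      exists_lower_corrector (h : Matrix (Fin (n + 1)) (Fin (n + 1)) (ZMod p)) hj hne
    have hshape := hC2 (h * u) (H₁.mul_mem hh (hL u hu)) (by rwa [Units.val_mul])
    have hzero : (((h * u : Matrix.GeneralLinearGroup (Fin (n + 1)) (ZMod p)) :
        Matrix (Fin (n + 1)) (Fin (n + 1)) (ZMod p)) - 1) 0 j = 0 := by
      by_contra hnz
      exact absurd (hshape 0 j hnz).1 (by simp)
    rw [Units.val_mul, Matrix.sub_apply, hcj, Matrix.one_apply_ne' hj, sub_zero] at hzero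
    exact hne hzero
  -- (C3) `H₃` has zero first column off the corner.
  have hC3 : ∀ h ∈ H₃, ∀ i : Fin (n + 1), i ≠ 0 →
      (h : Matrix (Fin (n + 1)) (Fin (n + 1)) (ZMod p)) i 0 = 0 := by
    intro h hh i hi
    by_contra hne
    obtain ⟨v, hv, hc0, hci⟩ :=
      exists_upper_corrector (h : Matrix (Fin (n + 1)) (Fin (n + 1)) (ZMod p)) hi hne
    have hshape := hC4 (v * h) (H₃.mul_mem (hR v hv) hh) (by rwa [Units.val_mul])
    have hi0 : (i : ℕ) ≠ 0 := fun h0 => hi (Fin.val_eq_zero_iff.mp h0)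
    have hzero : (((v * h : Matrix.GeneralLinearGroup (Fin (n + 1)) (ZMod p)) :
        Matrix (Fin (n + 1)) (Fin (n + 1)) (ZMod p)) - 1) i 0 = 0 := by
      by_contra hnz
      have hlt := (hshape i 0 hnz).1
      omega
    rw [Units.val_mul, Matrix.sub_apply, hci, Matrix.one_apply_ne hi, sub_zero] at hzero
    exact hne hzero
  exact ⟨hC1, hC2, hC3, hC4, hC5⟩

end Summit.MatrixMultiplication.MatrixMultiplication.Theorems.SubgroupIdentityDesigns.Negative
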